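import Mathlib
import HarnessLib
import Summits.HubbardSuperconductivity.HubbardSuperconductivity.Theorems.KLProgrammeC4aPathComparability
import Summits.HubbardSuperconductivity.HubbardSuperconductivity.Theorems.KLProgrammeC4aPathRigidity
import Summits.HubbardSuperconductivity.HubbardSuperconductivity.Theorems.KLProgrammeH10TwoPointLimitPerturbedNormalAngleLipschitz

/-!
# Route `KLProgramme` — crux C4a, S3 brick (B2-trans)(b) GEOMETRY, part 1: CHORD BOUNDS of the co-moving chart on the TORUS of angles —
# `(2u_min/π)·‖s − t‖_𝕋 ≤ ‖Φ(ρ,s) − Φ(ρ′,t)‖`, `(2u_min/π)·‖s − t − π‖_𝕋 ≤ ‖Φ(ρ,s) + Φ(ρ′,t)‖`, `‖Φ(ρ,s) − Φ(ρ,t)‖ ≤ D₁·‖s − t‖_𝕋`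

Cell `gate-hubbard-kl`, seat hubbard-kl-k3c3-p3 g19 (row «implicit-function / monotonicity route for μ(n)»); helper for stub (C) `stub_twoLeg_curvature`
of the engine-flow child `KLRegimeEngineV17F2` (stmt-HubbardSuperconductivity-20437), lane hubbard-kl-c4a-1's S3 plan (memo HOME/hubbard-kl-c4a-1/C4A-PLAN.md
§24.10 (B2-trans)(b); this row's located note HOME/hubbard-kl-k3c3-p3/B2TRANS-UMKLAPP.md).  WHY: the direct-sheet non-degeneracy of the partner energy on
the co-moving loop («|ē| + |∂_φē| ≥ c(δ)») is proved by ALIGNMENT (a small crossing slope forces the loop angle and the partner angle to agree mod π,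
k3c2-p2's `angle_alternative_level_of_geomConstants`) followed by CHORD geometry of the level curves: the Cooper branch needs a LOWER bound on
`‖Φ(0,θ) + Φ(ρ,ϑ+θ)‖` (c4a-1's `norm_pairSumPath_zero_ge` in the `|ϑ − π|` currency; here the torus-distance twin for arbitrary levels), the tangency
branch needs both the lower chord bound and the angular Lipschitz bound in the torus distance `‖·‖_𝕋 = torusDist`.  Elementary planar facts:
* §1 `norm_toLp_smul_dir_sub_sq` (`‖r₁dir a − r₂dir b‖² = (r₁ − r₂)² + 4r₁r₂ sin²((a−b)/2)`), `two_mul_abs_sin_half_le_norm_sub`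
  (`2m·|sin((a−b)/2)| ≤ ‖r₁dir a − r₂dir b‖` for `m ≤ r₁, r₂`), `torusDist_le_pi'`, `torusDist_le_pi_mul_abs_sin_half` (`‖x‖_𝕋 ≤ π|sin(x/2)|`, Jordan);
* §2 **`norm_levelPoint_sub_ge_torusDist`**, **`norm_levelPoint_add_ge_torusDist`** — the lower chord bounds at any two tube levels (radii `≥ u_min`);
* §3 **`norm_levelPoint_sub_le_torusDist`** — `‖Φ(ρ,s) − Φ(ρ,t)‖ ≤ msD A₃ A₄ 1·‖s − t‖_𝕋` (mean value along the shorter arc, `2π`-periodicity).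
Pure geometry of landed objects in c4a-1's binder shape; nothing about the model's sizes; nothing asserts superconductivity.
References: FST II CPAM 51 (1998) §3; BGM 2003 §7.1 Lemma 7.1 [cite: BenfattoGiulianiMastropietro2003]; BGM 2006 §2.4 (2.40) [cite: BenfattoGiulianiMastropietro2006].
-/

noncomputable section

namespace Summit.HubbardSuperconductivity.HubbardSuperconductivity.Theorems.C4a

set_option linter.dupNamespace false -- summit = problem name (single-conjunct summit), D-0017

open Real Set
open Literature.MathematicalPhysics.QuantumLattice Literature.MathematicalPhysics.QuantumLattice.BandSectorCounting
open Literature.MathematicalPhysics.QuantumLattice.FermiRG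
open Summit.HubbardSuperconductivity.HubbardSuperconductivity.Theorems.KLRegimeSplit
open Summit.HubbardSuperconductivity.HubbardSuperconductivity.Theorems.DispersionFlow
open Summit.HubbardSuperconductivity.HubbardSuperconductivity.Theorems.PerturbedFermiCurve

/-! ## §1 Planar chords and the torus distance -/

/-- **The chord identity**: `‖r₁·dir a − r₂·dir b‖² = (r₁ − r₂)² + 4 r₁ r₂ sin²((a − b)/2)`. -/
theorem norm_toLp_smul_dir_sub_sq (r₁ r₂ a b : ℝ) :
    ‖(WithLp.toLp 2 (r₁ • dir a) : Momentum) - WithLp.toLp 2 (r₂ • dir b)‖ ^ 2 =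
      (r₁ - r₂) ^ 2 + 4 * (r₁ * r₂) * Real.sin ((a - b) / 2) ^ 2 := by
  rw [← WithLp.toLp_sub, EuclideanSpace.norm_eq, Real.sq_sqrt (Finset.sum_nonneg fun i _ => sq_nonneg _), Fin.sum_univ_two]
  simp only [Pi.sub_apply, Pi.smul_apply, smul_eq_mul, dir_zero, dir_one, Real.norm_eq_abs, sq_abs]
  have hcos : Real.cos (a - b) = 1 - 2 * Real.sin ((a - b) / 2) ^ 2 := by
    have := Real.cos_two_mul_eq_one_sub ((a - b) / 2)
    rwa [show 2 * ((a - b) / 2) = a - b by ring] at this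
  have h3 := Real.cos_sub a b
  linear_combination r₁ ^ 2 * Real.sin_sq_add_cos_sq a + r₂ ^ 2 * Real.sin_sq_add_cos_sq b + 2 * r₁ * r₂ * h3 - 2 * r₁ * r₂ * hcos

/-- **Lower chord bound**: if `0 ≤ m ≤ r₁, r₂` then `2m·|sin((a − b)/2)| ≤ ‖r₁·dir a − r₂·dir b‖`. -/
theorem two_mul_abs_sin_half_le_norm_sub {m r₁ r₂ : ℝ} (hm : 0 ≤ m) (h₁ : m ≤ r₁) (h₂ : m ≤ r₂) (a b : ℝ) :
    2 * m * |Real.sin ((a - b) / 2)| ≤ ‖(WithLp.toLp 2 (r₁ • dir a) : Momentum) - WithLp.toLp 2 (r₂ • dir b)‖ := by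
  have hsq := norm_toLp_smul_dir_sub_sq r₁ r₂ a b
  have hn : 0 ≤ ‖(WithLp.toLp 2 (r₁ • dir a) : Momentum) - WithLp.toLp 2 (r₂ • dir b)‖ := norm_nonneg _
  have hprod : m ^ 2 ≤ r₁ * r₂ := by rw [sq]; exact mul_le_mul h₁ h₂ hm (hm.trans h₁)
  have hs2 : 0 ≤ Real.sin ((a - b) / 2) ^ 2 := sq_nonneg _
  have hl : (2 * m * |Real.sin ((a - b) / 2)|) ^ 2 ≤ ‖(WithLp.toLp 2 (r₁ • dir a) : Momentum) - WithLp.toLp 2 (r₂ • dir b)‖ ^ 2 := by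
    rw [hsq, mul_pow, mul_pow, sq_abs]
    nlinarith [sq_nonneg (r₁ - r₂)]
  have h0 : 0 ≤ 2 * m * |Real.sin ((a - b) / 2)| := by positivity
  exact (pow_le_pow_iff_left₀ h0 hn two_ne_zero).1 hl

/-- `‖x‖_𝕋 ≤ π` (half the period). -/
theorem torusDist_le_pi' (x : ℝ) : torusDist x ≤ π := by
  have h := AddCircle.norm_le_half_period (2 * π) Real.two_pi_pos.ne' (x := (x : AddCircle (2 * π)))
  -- `h : ‖↑x‖ ≤ |2 * π| / 2`
  have e : |2 * π| / 2 = π := by rw [abs_of_pos Real.two_pi_pos]; ring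
  rw [e] at h
  exact h

/-- **Jordan on the torus**: `‖x‖_𝕋 ≤ π·|sin(x/2)|`. -/
theorem torusDist_le_pi_mul_abs_sin_half (x : ℝ) : torusDist x ≤ π * |Real.sin (x / 2)| := by
  obtain ⟨k, hk⟩ := exists_torusDist_eq_abs x
  set y : ℝ := x + k * (2 * π) with hy
  have hyπ : |y| ≤ π := by rw [← hk]; exact torusDist_le_pi' x
  -- `|sin(x/2)| = |sin(y/2)|`
  have hsin : |Real.sin (x / 2)| = |Real.sin (y / 2)| := by
    have e : y / 2 = x / 2 + k * π := by rw [hy]; ring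
    rw [e, Real.sin_add_int_mul_pi, abs_mul, abs_zpow, abs_neg, abs_one, one_zpow, one_mul]
  rw [hk, hsin]
  -- Jordan for `|y/2| ≤ π/2`
  have hj : ∀ z : ℝ, 0 ≤ z → z ≤ π / 2 → z ≤ π / 2 * Real.sin z := fun z hz0 hz1 => by
    have h := Real.mul_le_sin hz0 hz1
    have e : π / 2 * (2 / π * z) = z := by field_simp
    calc z = π / 2 * (2 / π * z) := e.symm
      _ ≤ π / 2 * Real.sin z := mul_le_mul_of_nonneg_left h (by positivity)
  rcases le_or_gt 0 y with h0 | h0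
  · have h1 : y / 2 ≤ π / 2 := by have := (abs_le.1 hyπ).2; linarith
    have h2 := hj (y / 2) (by linarith) h1
    have hs0 : 0 ≤ Real.sin (y / 2) := Real.sin_nonneg_of_nonneg_of_le_pi (by linarith) (by linarith)
    rw [abs_of_nonneg h0, abs_of_nonneg hs0]; linarith
  · have h1 : -y / 2 ≤ π / 2 := by have := (abs_le.1 hyπ).1; linarith
    have h2 := hj (-y / 2) (by linarith) h1
    have hs0 : 0 ≤ Real.sin (-y / 2) := Real.sin_nonneg_of_nonneg_of_le_pi (by linarith) (by linarith)
    have e : Real.sin (-y / 2) = -Real.sin (y / 2) := by rw [show -y / 2 = -(y / 2) by ring, Real.sin_neg]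
    rw [abs_of_neg h0, abs_of_nonpos (by linarith [e ▸ hs0]), ]; linarith [e ▸ h2, e ▸ hs0]

/-! ## §2 Lower chord bounds of the level curves (any two tube levels) -/

section Band

variable {a b : ℝ} (B : BandBounds a b) {K : TrigPolyC4v} {A : ℝ} (hA : ∀ p : Momentum, ∀ j ≤ 2, ‖iteratedFDeriv ℝ j (frameShift K) p‖ ≤ A)
  {μ : ℝ}
include B hA

/-- **Lower chord bound on the torus**: for two tube levels `ρ, ρ′` (radii `≥ u_min`) and any angles,
`(2u_min/π)·‖s − t‖_𝕋 ≤ ‖Φ(ρ,s) − Φ(ρ′,t)‖`. [cite: BenfattoGiulianiMastropietro2003, §7.1 Lemma 7.1] -/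
theorem norm_levelPoint_sub_ge_torusDist {ρ ρ' : ℝ} (hlo : a ≤ μ + ρ - A) (hhi : μ + ρ + A ≤ b) (hlo' : a ≤ μ + ρ' - A)
    (hhi' : μ + ρ' + A ≤ b) (s t : ℝ) :
    2 * B.umin / π * torusDist (s - t) ≤ ‖levelPoint μ K ρ s - levelPoint μ K ρ' t‖ := by
  have hu₁ := KLRegimeSplit.umin_le_frameRadius B hA hlo hhi s
  have hu₂ := KLRegimeSplit.umin_le_frameRadius B hA hlo' hhi' t
  have hm := B.umin_pos.le
  have h := two_mul_abs_sin_half_le_norm_sub hm hu₁ hu₂ s t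
  rw [levelPoint_eq_toLp_smul_dir, levelPoint_eq_toLp_smul_dir]
  refine le_trans ?_ h
  have hj := torusDist_le_pi_mul_abs_sin_half (s - t)
  rw [div_mul_eq_mul_div, div_le_iff₀ Real.pi_pos]
  calc 2 * B.umin * torusDist (s - t) ≤ 2 * B.umin * (π * |Real.sin ((s - t) / 2)|) := mul_le_mul_of_nonneg_left hj (by positivity)
    _ = 2 * B.umin * |Real.sin ((s - t) / 2)| * π := by ring

/-- **Lower bound for SUMS** (the Cooper chord): `(2u_min/π)·‖s − t − π‖_𝕋 ≤ ‖Φ(ρ,s) + Φ(ρ′,t)‖` (`Φ(ρ′,t) = −Φ(ρ′,t+π)`).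
[cite: BenfattoGiulianiMastropietro2003, §7.1 Lemma 7.1] -/
theorem norm_levelPoint_add_ge_torusDist {ρ ρ' : ℝ} (hlo : a ≤ μ + ρ - A) (hhi : μ + ρ + A ≤ b) (hlo' : a ≤ μ + ρ' - A)
    (hhi' : μ + ρ' + A ≤ b) (s t : ℝ) :
    2 * B.umin / π * torusDist (s - t - π) ≤ ‖levelPoint μ K ρ s + levelPoint μ K ρ' t‖ := by
  have h := norm_levelPoint_sub_ge_torusDist B hA hlo hhi hlo' hhi' s (t + π)
  rw [levelPoint_add_pi, sub_neg_eq_add, show s - (t + π) = s - t - π by ring] at h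
  exact h

end Band

/-! ## §3 The angular Lipschitz bound on the torus -/

section Sizes

variable {K : TrigPolyC4v} {A : ℝ} (hA : ∀ p : Momentum, ∀ j ≤ 2, ‖iteratedFDeriv ℝ j (frameShift K) p‖ ≤ A) (hA20 : A ≤ 1 / 20)
  (hd : klCurveD ≤ (bandBounds (show (-4 : ℝ) < -1.1 by norm_num) (show (-1.1 : ℝ) ≤ -0.1 by norm_num)
    (show (-0.1 : ℝ) < 0 by norm_num)).Dtmin - 2 * A)
  {μ r : ℝ} (hr : 0 < r) (hlo : (-1.1 : ℝ) < μ - r - A) (hhi : μ + r + A < -0.1)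
  {A₃ A₄ : ℝ} (hA₃ : ∀ p : Momentum, ‖iteratedFDeriv ℝ 3 (frameShift K) p‖ ≤ A₃)
  (hA₄ : ∀ p : Momentum, ‖iteratedFDeriv ℝ 4 (frameShift K) p‖ ≤ A₄)
include hA hA20 hd hr hlo hhi hA₃ hA₄

omit hr in
/-- **Angular Lipschitz bound, real-line form**: `‖Φ(ρ,s) − Φ(ρ,t)‖ ≤ msD A₃ A₄ 1·|s − t|` (mean value, `‖∂_sΦ‖ ≤ msD A₃ A₄ 1`).
[cite: BenfattoGiulianiMastropietro2006, §2.4 Lemma 2.1 (2.40)] -/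
theorem norm_levelPoint_sub_le_abs {ρ : ℝ} (hρ : |ρ| < r) (s t : ℝ) :
    ‖levelPoint μ K ρ s - levelPoint μ K ρ t‖ ≤ msD A₃ A₄ 1 * |s - t| := by
  have hdiff : Differentiable ℝ (levelPoint μ K ρ) := (contDiff_levelPoint_of_sizes hA hd hlo hhi hρ 1).differentiable (by norm_num)
  have hb : ∀ x ∈ Set.univ, ‖deriv (levelPoint μ K ρ) x‖ ≤ msD A₃ A₄ 1 := fun x _ => by
    rw [← iteratedDeriv_one]; exact norm_iteratedDeriv_levelPoint_le hA hA20 hd hlo hhi hA₃ hA₄ hρ le_rfl (by norm_num) x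
  have h := Convex.norm_image_sub_le_of_norm_deriv_le (fun x _ => hdiff x) hb convex_univ (Set.mem_univ t) (Set.mem_univ s)
  rwa [← Real.norm_eq_abs]

omit hr in
/-- **Angular Lipschitz bound on the torus**: `‖Φ(ρ,s) − Φ(ρ,t)‖ ≤ msD A₃ A₄ 1·‖s − t‖_𝕋` (`2π`-periodicity: measure along the shorter arc).
[cite: BenfattoGiulianiMastropietro2006, §2.4 Lemma 2.1 (2.40)] -/
theorem norm_levelPoint_sub_le_torusDist {ρ : ℝ} (hρ : |ρ| < r) (s t : ℝ) :
    ‖levelPoint μ K ρ s - levelPoint μ K ρ t‖ ≤ msD A₃ A₄ 1 * torusDist (s - t) := by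
  obtain ⟨k, hk⟩ := exists_torusDist_eq_abs (s - t)
  -- move `t` by `-2πk`
  have hper : ∀ (x : ℝ) (m : ℕ), levelPoint μ K ρ (x + m * (2 * π)) = levelPoint μ K ρ x := by
    intro x m
    induction m with
    | zero => simp
    | succ m ih => rw [Nat.cast_succ, add_mul, one_mul, ← add_assoc, levelPoint_add_two_pi, ih]
  have hperZ : ∀ (x : ℝ) (m : ℤ), levelPoint μ K ρ (x + m * (2 * π)) = levelPoint μ K ρ x := by
    intro x m
    obtain ⟨n, rfl | rfl⟩ := m.eq_nat_or_neg
    · exact_mod_cast hper x n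
    · have h := hper (x + (-(n : ℤ) : ℤ) * (2 * π)) n
      have e : x + ((-(n : ℤ) : ℤ) : ℝ) * (2 * π) + (n : ℝ) * (2 * π) = x := by push_cast; ring
      rw [e] at h
      exact h.symm
  have ht : levelPoint μ K ρ t = levelPoint μ K ρ (t - k * (2 * π)) := by
    have h := hperZ (t - k * (2 * π)) k
    rw [show t - k * (2 * π) + k * (2 * π) = t by ring] at h
    exact h
  rw [ht, hk, show s - t + k * (2 * π) = s - (t - k * (2 * π)) by ring]
  exact norm_levelPoint_sub_le_abs hA hA20 hd hlo hhi hA₃ hA₄ hρ s _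

end Sizes

end Summit.HubbardSuperconductivity.HubbardSuperconductivity.Theorems.C4a

end
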